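import Literature.NumberTheory.LFunctions.Zhang2022.Section12ShiftedContourZ22
import Literature.NumberTheory.LFunctions.Zhang2022.Section12ShiftedSmallCircleOmega
import HarnessLib

/-!
# Zhang (2022) §12, Lemmas 12.2–12.3: the Perron line integral EVALUATED — big contour (Z22 instance)
# composed with the `ω₁`-small-circle evaluation, under the lane's standing quantifier (theorems only)

Topic `Literature/NumberTheory/LFunctions/Zhang2022` (Landau–Siegel audit tree; verdict-neutral).
Y. Zhang, *Discrete mean estimates and the Landau–Siegel zero*, arXiv:2211.02515v1 (2022)
[Zhang2022LandauSiegel] — **an unrefereed manuscript under adjudication** (lane ZHANG-L, WP12; helper under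
the cores `Typed.Sec12B.U025Rel` (leaf h1212) and `U030Rel` (leaf hTop25Ex)). Everything here is PROVED;
no new definitions, no named facts; nothing here is a claim about Theorems 1–2 of the source.

DAG nodes served: `Z22:§12.u025` (p. 69, tex L3534) and `Z22:§12.u030` (p. 70, tex L3564): "In a way similar
to the proof of Lemma 8.4, by lemma 8.2 and 5.8, we find that [the Perron integral on `(1)`] is equal to
`L′(1,χ)Π(d,r)·(2πi)⁻¹∫_{|s|=5α}(…) + O(𝓛⁻¹⁵)`". This file is the COMPOSITION of the two landed layers of
the lane's route of record (rulings S-8/S-8c):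

* zl-libB-p5's `ShiftedContour.norm_vline_sub_circ_le_Z22` (file `Section12ShiftedContourZ22`): the Landau
  contour at the manuscript's objects, `‖vline(Y) − (2πi)⁻¹∮_{C(s₀,3α)}Φ·K_Y‖ ≤ C₀𝓛⁻¹⁵` (absolute), and
* `Lemma84.circ_omega1_eval_forAllLarge` (file `Section12ShiftedSmallCircleOmega`): the small circle,
  `‖(2πi)⁻¹∮_{C(β₆−w,3α)}Φ·K_Y − Π(d,r)L′(1,χ)·model(Y,w)‖ ≤ C·𝓛⁻¹⁵·Π̂(dr)²`,

into ONE statement per kernel, every side condition discharged inside (`Re β_j = 0`, `‖β_j‖ ≤ 1/2`,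
`‖β₆ − w‖ ≤ 5α/2`, `Im(β₆ − w) ≠ 0`, `log(dr) ≤ 𝓛⁹`, the Lemma 5.7/5.8 package):

* **`vline_sub_main_le_forAllLarge`** — for `c′`, `C₈₃` real: `∃ C ≥ 0`, `ForAllLarge`, (A) `→` for all
  `j`, `d, r ≥ 1` with `dr ≤ P`, every continuation `𝔲` with Lemma 8.3's clauses (i), (ii), (iii′)
  (`Skeleton.Lemma83Rel` — a theorem of the tree, `Skeleton.lemma83Rel_holds`), every `|w| = α`, every `Φ` with
  `Φ(s) = 𝔲(1−s₀+s)L(1−s₀+s+β_{j+1})L(1−s₀+s+β_{j+2})/L(1−s₀+s)`, `s₀ = β₆ − w` (the spelling of the Z22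
  instance), and `T ≤ Y ≤ P`:
  `‖(1/2π)∫_ℝ Φ(1+it)Y^{1+it}ω₁(1+it)/(1+it)dt − Π(d,r)L′(1,χ)·(w − β₆ + β_{j+1} + β_{j+2}
     + β_{j+1}β_{j+2}(Y^{β₆−w} − 1)/(β₆−w))‖ ≤ C·𝓛⁻¹⁵·Π̂(dr)²`
  (`ω₁ = omega1 (𝓛³⁰)`; the value is `Π L′(1,χ)·circ030` for `Y = P″₂/dr`, `Typed.Sec12B.U031_holds`);
* **`vline_pair_sub_main_le_forAllLarge`** — the u025 form: two lengths `Y₂, Y₁ ∈ [T, P]`, the difference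
  of the line integrals against `Π(d,r)L′(1,χ)·β_{j+1}β_{j+2}(Y₂^{β₆−w} − Y₁^{β₆−w})/(β₆−w)`
  (`= Π L′·circ025`, `Typed.Sec12B.circ025_eq`), error `C·𝓛⁻¹⁵·Π̂(dr)²`.

Remaining steps of the two cores (their owners'): u030 — unsmoothing (`XiZeroMajorant.xi_sharp_sub_smooth_le`)
and Perron (`Φ(1+it) = Σ_l χ(l)ξ₀ⱼ(l;d,r)l^{−(2−β₆+w+it)}`, `GaussWeight.integral_LSeries_mul_kernel`); u025 —
`lineInt024` as the difference of two such line integrals. «ZHANG-L proves typed steps of arXiv:2211.02515v1 in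
Lean; the §18 margin is refuted as printed (G-C1); no claim about Landau–Siegel zeros or Theorem 2 follows.»

## References

* Y. Zhang, arXiv:2211.02515v1 (2022), §12 proofs of Lemmas 12.2–12.3, pp. 69–70 (tex L3528–L3586); §8 proof
  of Lemma 8.4, p. 47; §5 Lemmas 5.5, 5.7, 5.8; §4 (4.1). [cite: Zhang2022LandauSiegel, §12 Lemmas 12.2–12.3]
* H. L. Montgomery, R. C. Vaughan, *Multiplicative Number Theory I*, CUP 2007, §6.2.
  [cite: MontgomeryVaughan2007, §6.2]
-/

noncomputable section

open Complex Real Set Metric MeasureTheory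

namespace Literature.NumberTheory.LFunctions.Zhang2022.Lemma84

namespace ShiftedContour

open Skeleton GaussWeight

/-- `M ≤ log D` for all large `D`. [folklore] -/
private theorem exists_nat_le_log'' (M : ℝ) : ∃ D₀ : ℕ, ∀ D : ℕ, D₀ ≤ D → M ≤ Real.log D := by
  refine ⟨⌈Real.exp M⌉₊ + 1, fun D hD => ?_⟩
  have h1 : Real.exp M ≤ D := by
    have : (⌈Real.exp M⌉₊ : ℝ) + 1 ≤ D := by exact_mod_cast hD
    linarith [Nat.le_ceil (Real.exp M)]
  have hD0 : (0 : ℝ) < D := lt_of_lt_of_le (Real.exp_pos M) h1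
  rw [Real.le_log_iff_exp_le hD0]
  exact h1

/-- `Im β₆ = 3α/2` (`β₆ = 3iα/2`). [cite: Zhang2022LandauSiegel, §2 (2.22)] -/
private theorem beta6_im' (D : ℕ) : (beta6 D).im = 3 * alpha D / 2 := by
  simp [beta6]

/-- For `|w| = α > 0`: `Im(β₆ − w) ≠ 0` (indeed `≥ α/2`). [cite: Zhang2022LandauSiegel, §12 proof of Lemma 12.2, p. 69] -/
private theorem beta6_sub_im_ne_zero {D : ℕ} (hα : 0 < alpha D) {w : ℂ} (hw : ‖w‖ = alpha D) :
    (beta6 D - w).im ≠ 0 := by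
  have h := Complex.abs_im_le_norm w
  rw [hw] at h
  have h' := (abs_le.mp h).2
  rw [Complex.sub_im, beta6_im']
  intro h0
  linarith

/-- **The Perron line integral, evaluated (kernel `Y^sω₁(s)/s`)** — see the module docstring: `∃ C ≥ 0`,
`ForAllLarge`, (A), `∀ j`, `d r ≠ 0` with `dr ≤ P`, `∀ 𝔲` with Lemma 8.3 (i), (ii), (iii′), `∀ |w| = α`, `∀ Φ` with
`Φ(s) = 𝔲(1−(β₆−w)+s)L(…+β_{j+1})L(…+β_{j+2})/L(1−(β₆−w)+s)`, `∀ Y ∈ [T, P]`: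
`‖(1/2π)∫Φ(1+it)Y^{1+it}ω₁(1+it)/(1+it)dt − Π(d,r)L′(1,χ)·(w − β₆ + β_{j+1} + β_{j+2} + β_{j+1}β_{j+2}(Y^{β₆−w}−1)/(β₆−w))‖
≤ C·𝓛⁻¹⁵·Π̂(dr)²` = `norm_vline_sub_circ_le_Z22` (k = 15) + `Lemma84.circ_omega1_eval_forAllLarge` (Λ = 𝓛³⁰).
[cite: Zhang2022LandauSiegel, §12 proof of Lemma 12.3, p. 70, tex L3564] [cite: Zhang2022LandauSiegel, §12 proof of Lemma 12.2, p. 69, tex L3534] -/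
theorem vline_sub_main_le_forAllLarge (c' C₈₃ : ℝ) :
    ∃ C : ℝ, 0 ≤ C ∧ ForAllLarge fun D _ χ => AssumptionA D χ →
      ∀ j d r : ℕ, d ≠ 0 → r ≠ 0 → ((d * r : ℕ) : ℝ) ≤ bigP D → ∀ U : ℂ → ℂ,
        DifferentiableOn ℂ U {s : ℂ | 9 / 10 < s.re} →
        (∀ s : ℂ, 9 / 10 < s.re →
          ‖U s‖ ≤ C₈₃ * ∏ q ∈ (d * r).primeFactors, (1 + C₈₃ * (q : ℝ) ^ (-s.re))) →
        (∀ s : ℂ, ‖s - 1‖ ≤ 5 * alpha D → ‖U s - PiW χ d r‖ ≤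
            C₈₃ * (ell D ^ 8)⁻¹ * ∏ q ∈ (d * r).primeFactors, (1 - (q : ℝ)⁻¹)⁻¹) →
        ∀ w : ℂ, ‖w‖ = alpha D → ∀ Φ : ℂ → ℂ,
          (∀ s, Φ s = U (1 - (beta6 D - w) + s) * χ.LFunction (1 - (beta6 D - w) + s + betaJ c' D (j + 1)) *
            χ.LFunction (1 - (beta6 D - w) + s + betaJ c' D (j + 2)) / χ.LFunction (1 - (beta6 D - w) + s)) →
          ∀ Y : ℝ, bigT D ≤ Y → Y ≤ bigP D →
            ‖(1 / (2 * π) : ℂ) * (∫ t : ℝ, Φ (((1 : ℝ) : ℂ) + t * I) *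
                  ((Y : ℂ) ^ (((1 : ℝ) : ℂ) + t * I + 0) * omega1 (ell D ^ 30) (((1 : ℝ) : ℂ) + t * I + 0) /
                    (((1 : ℝ) : ℂ) + t * I + 0))) -
                PiW χ d r * deriv χ.LFunction 1 *
                  (w - beta6 D + betaJ c' D (j + 1) + betaJ c' D (j + 2) +
                    betaJ c' D (j + 1) * betaJ c' D (j + 2) *
                      ((((Y : ℝ) : ℂ) ^ (beta6 D - w) - 1) / (beta6 D - w)))‖ ≤
              C * (ell D ^ 15)⁻¹ * (∏ q ∈ (d * r).primeFactors, (1 - (q : ℝ)⁻¹)⁻¹) ^ 2 := by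
  -- the two layers, with `|C₈₃|`
  obtain ⟨C₀, hC₀0, D₁, hZ⟩ := norm_vline_sub_circ_le_Z22 (abs_nonneg C₈₃) 15
  obtain ⟨C₁, hC₁0, D₂, hC⟩ := circ_omega1_eval_forAllLarge c' C₈₃
  -- threshold for `‖β_j‖ ≤ 1/2` and `𝓛 ≥ 3`
  obtain ⟨D₃, hD₃⟩ := exists_nat_le_log'' (max 3 (6 * π * (1 + 5 * |c'|)))
  refine ⟨C₀ + C₁, by positivity, max (max D₁ D₂) D₃, ?_⟩
  intro D _ χ hD hq hp hA j d r hd hr hdrP U hUd hUbd hU3 w hw Φ hΦ Y hTY hYP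
  have hD₁ : D₁ ≤ D := le_trans (le_trans (le_max_left _ _) (le_max_left _ _)) hD
  have hD₂ : D₂ ≤ D := le_trans (le_trans (le_max_right _ _) (le_max_left _ _)) hD
  have hLm := hD₃ D (le_trans (le_max_right _ _) hD)
  have h𝓛3 : 3 ≤ Real.log D := le_trans (le_max_left _ _) hLm
  have hLc : 6 * π * (1 + 5 * |c'|) ≤ Real.log D := le_trans (le_max_right _ _) hLm
  have hℓ1 : 1 ≤ ell D := by rw [ell]; linarith
  have hℓ2 : 2 ≤ ell D := by rw [ell]; linarith
  have hα : 0 < alpha D := alpha_pos' (by linarith)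
  have hπ := Real.pi_pos
  -- `D ≥ 2`, `χ ≠ 1`, (A) in the `⁻¹` spelling
  have hD0 : (0 : ℝ) < D := by
    rcases lt_or_ge 0 (D : ℝ) with h | h
    · exact h
    · have : Real.log (D : ℝ) ≤ 0 := by
        have : (D : ℝ) = 0 := le_antisymm h (Nat.cast_nonneg D)
        rw [this, Real.log_zero]
      linarith
  have hD3 : (3 : ℝ) ≤ D := by
    have hDexp : (D : ℝ) = Real.exp (Real.log D) := by rw [Real.exp_log hD0]
    have : Real.exp 3 ≤ Real.exp (Real.log D) := Real.exp_le_exp.2 h𝓛3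
    have h3 : (3 : ℝ) ≤ Real.exp 3 := by have := Real.add_one_le_exp (3 : ℝ); linarith
    linarith
  have hD2 : 2 ≤ D := by exact_mod_cast (show (2 : ℝ) ≤ D by linarith)
  have hχ1 : χ ≠ 1 := Lemma31.ne_one_of_isPrimitive χ hD2 hp
  have hA' : ‖χ.LFunction 1‖ < (Real.log D ^ 2022)⁻¹ := by rw [← one_div]; exact hA
  -- `dr ≠ 0`, `log(dr) ≤ 𝓛⁹`
  have hdr0 : d * r ≠ 0 := mul_ne_zero hd hr
  have hlogdr : Real.log ((d * r : ℕ) : ℝ) ≤ Real.log D ^ 9 := by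
    have h2 : (0 : ℝ) < ((d * r : ℕ) : ℝ) := by exact_mod_cast Nat.pos_of_ne_zero hdr0
    calc Real.log ((d * r : ℕ) : ℝ) ≤ Real.log (bigP D) := Real.log_le_log h2 hdrP
      _ = Real.log D ^ 9 := by rw [bigP, Real.log_exp, ell]
  -- the `U`-bounds with `|C₈₃|`
  have hUbd' : ∀ s : ℂ, 9 / 10 < s.re →
      ‖U s‖ ≤ |C₈₃| * ∏ q ∈ (d * r).primeFactors, (1 + |C₈₃| * (q : ℝ) ^ (-s.re)) := by
    intro s hs
    calc ‖U s‖ ≤ C₈₃ * ∏ q ∈ (d * r).primeFactors, (1 + C₈₃ * (q : ℝ) ^ (-s.re)) := hUbd s hs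
      _ ≤ |C₈₃ * ∏ q ∈ (d * r).primeFactors, (1 + C₈₃ * (q : ℝ) ^ (-s.re))| := le_abs_self _
      _ = |C₈₃| * ∏ q ∈ (d * r).primeFactors, |1 + C₈₃ * (q : ℝ) ^ (-s.re)| := by
          rw [abs_mul, Finset.abs_prod]
      _ ≤ |C₈₃| * ∏ q ∈ (d * r).primeFactors, (1 + |C₈₃| * (q : ℝ) ^ (-s.re)) := by
          refine mul_le_mul_of_nonneg_left ?_ (abs_nonneg _)
          refine Finset.prod_le_prod (fun _ _ => abs_nonneg _) fun q _ => ?_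
          calc |1 + C₈₃ * (q : ℝ) ^ (-s.re)| ≤ |(1 : ℝ)| + |C₈₃ * (q : ℝ) ^ (-s.re)| := abs_add_le _ _
            _ = 1 + |C₈₃| * (q : ℝ) ^ (-s.re) := by
                rw [abs_one, abs_mul, abs_of_nonneg (Real.rpow_nonneg (Nat.cast_nonneg q) _)]
  -- the shifts
  have hβre : ∀ i : ℕ, (betaJ c' D i).re = 0 := fun i => betaJ_re c' D i
  have hβhalf : ∀ i : ℕ, ‖betaJ c' D i‖ ≤ 1 / 2 := by
    intro i
    have h := norm_betaJ_le c' D i hα.le (by linarith : 0 ≤ ell D)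
    have hαℓ : alpha D * ell D ≤ 1 := alpha_mul_ell_le_one hℓ2
    have h1 : ‖betaJ c' D i‖ ≤ 3 * alpha D * (1 + 5 * |c'|) := by
      refine h.trans ?_
      have : 5 * |c'| * alpha D * ell D ≤ 5 * |c'| := by
        calc 5 * |c'| * alpha D * ell D = 5 * |c'| * (alpha D * ell D) := by ring
          _ ≤ 5 * |c'| * 1 := by gcongr
          _ = 5 * |c'| := mul_one _
      nlinarith [abs_nonneg c']
    -- `α ≤ π/𝓛` and `6π(1+5|c′|) ≤ 𝓛`
    have hαeq : alpha D = π / Real.log D ^ 9 := alpha_eq D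
    have hαL : alpha D ≤ π / Real.log D := by
      rw [hαeq]
      refine div_le_div_of_nonneg_left hπ.le (by linarith) ?_
      calc Real.log D = Real.log D ^ 1 := (pow_one _).symm
        _ ≤ Real.log D ^ 9 := pow_le_pow_right₀ (by linarith) (by norm_num)
    have h2 : 3 * alpha D * (1 + 5 * |c'|) ≤ 1 / 2 := by
      have h3 : 3 * (π / Real.log D) * (1 + 5 * |c'|) ≤ 1 / 2 := by
        rw [show 3 * (π / Real.log D) * (1 + 5 * |c'|) = 3 * π * (1 + 5 * |c'|) / Real.log D by ring,
          div_le_iff₀ (by linarith)]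
        linarith
      have h4 : 3 * alpha D * (1 + 5 * |c'|) ≤ 3 * (π / Real.log D) * (1 + 5 * |c'|) := by
        have : 0 ≤ 1 + 5 * |c'| := by positivity
        nlinarith
      linarith
    exact h1.trans h2
  obtain ⟨-, hs₀, -⟩ := center_shift_bounds hα hw
  have hs₀im : (beta6 D - w).im ≠ 0 := beta6_sub_im_ne_zero hα hw
  -- the big contour
  have hZ' := hZ hD₁ χ hχ1 hA' U Φ (beta6 D - w) (betaJ c' D (j + 1)) (betaJ c' D (j + 2)) (n := d * r)
    (Y := Y) hdr0 hlogdr hUd hUbd' (hβre _) (hβhalf _) (hβre _) (hβhalf _) hs₀ hs₀im hΦ hTY hYP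
  -- the small circle (`Λ = 𝓛³⁰ ≥ 1`, `1 ≤ T ≤ Y`)
  have hT1 : 1 ≤ bigT D := by rw [bigT]; exact Real.one_le_exp_iff.mpr (by positivity)
  have hY1 : 1 ≤ Y := le_trans hT1 hTY
  have hΛ1 : (1 : ℝ) ≤ ell D ^ 30 := one_le_pow₀ hℓ1
  have hC' := hC D χ hD₂ hq hp hA j d r hd hr U hUd hU3 w hw Y hY1 hYP (ell D ^ 30) hΛ1
  -- the two circle integrals agree (`Φ` versus the explicit quotient)
  have e1 : ∀ z : ℂ, 1 - (beta6 D - w) + z = 1 - beta6 D + w + z := fun z => by ring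
  have hcirc : (∮ z in C(beta6 D - w, 3 * alpha D), Φ z *
        ((Y : ℂ) ^ (z + 0) * omega1 (ell D ^ 30) (z + 0) / (z + 0))) =
      ∮ z in C(beta6 D - w, 3 * alpha D),
        U (1 - beta6 D + w + z) * χ.LFunction (1 - beta6 D + w + z + betaJ c' D (j + 1)) *
            χ.LFunction (1 - beta6 D + w + z + betaJ c' D (j + 2)) / χ.LFunction (1 - beta6 D + w + z) *
          (((Y : ℝ) : ℂ) ^ (z + 0) * omega1 (ell D ^ 30) (z + 0) / (z + 0)) := by
    refine circleIntegral.integral_congr (by positivity) fun z _ => ?_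
    simp only [hΦ, e1]
  rw [hcirc] at hZ'
  -- triangle inequality and bookkeeping (`Π̂² ≥ 1`)
  have hP0 : 1 ≤ ∏ q ∈ (d * r).primeFactors, (1 - (q : ℝ)⁻¹)⁻¹ := by
    refine le_of_eq_of_le (Finset.prod_const_one (s := (d * r).primeFactors)).symm
      (Finset.prod_le_prod (fun _ _ => zero_le_one) fun q hq => ?_)
    have hq2 : (2 : ℝ) ≤ q := by exact_mod_cast (Nat.prime_of_mem_primeFactors hq).two_le
    have h1 : 0 < 1 - (q : ℝ)⁻¹ := by
      have : (q : ℝ)⁻¹ ≤ 1 / 2 := by rw [inv_eq_one_div]; gcongr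
      linarith
    have h2 : 1 - (q : ℝ)⁻¹ ≤ 1 := by
      have : 0 ≤ (q : ℝ)⁻¹ := by positivity
      linarith
    exact (one_le_inv₀ h1).mpr h2
  have hP1 : 1 ≤ (∏ q ∈ (d * r).primeFactors, (1 - (q : ℝ)⁻¹)⁻¹) ^ 2 := one_le_pow₀ hP0
  have hZ'' : C₀ * (ell D ^ 15)⁻¹ ≤
      C₀ * (ell D ^ 15)⁻¹ * (∏ q ∈ (d * r).primeFactors, (1 - (q : ℝ)⁻¹)⁻¹) ^ 2 := by
    have h0 : 0 ≤ C₀ * (ell D ^ 15)⁻¹ := by positivity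
    calc C₀ * (ell D ^ 15)⁻¹ = C₀ * (ell D ^ 15)⁻¹ * 1 := (mul_one _).symm
      _ ≤ _ := mul_le_mul_of_nonneg_left hP1 h0
  have htri := norm_sub_le_norm_sub_add_norm_sub
    ((1 / (2 * π) : ℂ) * (∫ t : ℝ, Φ (((1 : ℝ) : ℂ) + t * I) *
        ((Y : ℂ) ^ (((1 : ℝ) : ℂ) + t * I + 0) * omega1 (ell D ^ 30) (((1 : ℝ) : ℂ) + t * I + 0) /
          (((1 : ℝ) : ℂ) + t * I + 0))))
    ((2 * π * I)⁻¹ * (∮ z in C(beta6 D - w, 3 * alpha D),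
        U (1 - beta6 D + w + z) * χ.LFunction (1 - beta6 D + w + z + betaJ c' D (j + 1)) *
            χ.LFunction (1 - beta6 D + w + z + betaJ c' D (j + 2)) / χ.LFunction (1 - beta6 D + w + z) *
          (((Y : ℝ) : ℂ) ^ (z + 0) * omega1 (ell D ^ 30) (z + 0) / (z + 0))))
    (PiW χ d r * deriv χ.LFunction 1 *
      (w - beta6 D + betaJ c' D (j + 1) + betaJ c' D (j + 2) +
        betaJ c' D (j + 1) * betaJ c' D (j + 2) *
          ((((Y : ℝ) : ℂ) ^ (beta6 D - w) - 1) / (beta6 D - w))))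
  have hsum : C₀ * (ell D ^ 15)⁻¹ * (∏ q ∈ (d * r).primeFactors, (1 - (q : ℝ)⁻¹)⁻¹) ^ 2 +
        C₁ * (ell D ^ 15)⁻¹ * (∏ q ∈ (d * r).primeFactors, (1 - (q : ℝ)⁻¹)⁻¹) ^ 2 =
      (C₀ + C₁) * (ell D ^ 15)⁻¹ * (∏ q ∈ (d * r).primeFactors, (1 - (q : ℝ)⁻¹)⁻¹) ^ 2 := by ring
  rw [← hsum]
  exact htri.trans (add_le_add (hZ'.trans hZ'') hC')

/-- **The Perron line integrals at two lengths, evaluated (u025 form).** Same quantifiers, `Y₁, Y₂ ∈ [T, P]`: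
`‖[vline(Y₂) − vline(Y₁)] − Π(d,r)L′(1,χ)·β_{j+1}β_{j+2}(Y₂^{β₆−w} − Y₁^{β₆−w})/(β₆−w)‖ ≤ C·𝓛⁻¹⁵·Π̂(dr)²`
(the value is `Π L′(1,χ)·circ025` for `Y₂ = P″₂/dr`, `Y₁ = P″₁/dr`: `Typed.Sec12B.circ025_eq`; u025's
`lineInt024` is the difference of the two line integrals by `ShiftedContour.integrable_vline_Z22`).
[cite: Zhang2022LandauSiegel, §12 proof of Lemma 12.2, p. 69, tex L3534] -/
theorem vline_pair_sub_main_le_forAllLarge (c' C₈₃ : ℝ) :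
    ∃ C : ℝ, 0 ≤ C ∧ ForAllLarge fun D _ χ => AssumptionA D χ →
      ∀ j d r : ℕ, d ≠ 0 → r ≠ 0 → ((d * r : ℕ) : ℝ) ≤ bigP D → ∀ U : ℂ → ℂ,
        DifferentiableOn ℂ U {s : ℂ | 9 / 10 < s.re} →
        (∀ s : ℂ, 9 / 10 < s.re →
          ‖U s‖ ≤ C₈₃ * ∏ q ∈ (d * r).primeFactors, (1 + C₈₃ * (q : ℝ) ^ (-s.re))) →
        (∀ s : ℂ, ‖s - 1‖ ≤ 5 * alpha D → ‖U s - PiW χ d r‖ ≤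
            C₈₃ * (ell D ^ 8)⁻¹ * ∏ q ∈ (d * r).primeFactors, (1 - (q : ℝ)⁻¹)⁻¹) →
        ∀ w : ℂ, ‖w‖ = alpha D → ∀ Φ : ℂ → ℂ,
          (∀ s, Φ s = U (1 - (beta6 D - w) + s) * χ.LFunction (1 - (beta6 D - w) + s + betaJ c' D (j + 1)) *
            χ.LFunction (1 - (beta6 D - w) + s + betaJ c' D (j + 2)) / χ.LFunction (1 - (beta6 D - w) + s)) →
          ∀ Y₁ Y₂ : ℝ, bigT D ≤ Y₁ → Y₁ ≤ bigP D → bigT D ≤ Y₂ → Y₂ ≤ bigP D →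
            ‖((1 / (2 * π) : ℂ) * (∫ t : ℝ, Φ (((1 : ℝ) : ℂ) + t * I) *
                  ((Y₂ : ℂ) ^ (((1 : ℝ) : ℂ) + t * I + 0) * omega1 (ell D ^ 30) (((1 : ℝ) : ℂ) + t * I + 0) /
                    (((1 : ℝ) : ℂ) + t * I + 0))) -
                (1 / (2 * π) : ℂ) * (∫ t : ℝ, Φ (((1 : ℝ) : ℂ) + t * I) *
                  ((Y₁ : ℂ) ^ (((1 : ℝ) : ℂ) + t * I + 0) * omega1 (ell D ^ 30) (((1 : ℝ) : ℂ) + t * I + 0) /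
                    (((1 : ℝ) : ℂ) + t * I + 0)))) -
                PiW χ d r * deriv χ.LFunction 1 *
                  (betaJ c' D (j + 1) * betaJ c' D (j + 2) *
                    ((((Y₂ : ℝ) : ℂ) ^ (beta6 D - w) - ((Y₁ : ℝ) : ℂ) ^ (beta6 D - w)) / (beta6 D - w)))‖ ≤
              C * (ell D ^ 15)⁻¹ * (∏ q ∈ (d * r).primeFactors, (1 - (q : ℝ)⁻¹)⁻¹) ^ 2 := by
  obtain ⟨C, hC0, D₀, hC⟩ := vline_sub_main_le_forAllLarge c' C₈₃
  refine ⟨2 * C, by positivity, D₀, fun D _ χ hD hq hp hA j d r hd hr hdrP U hUd hUbd hU3 w hw Φ hΦ Y₁ Y₂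
    hY₁ hY₁P hY₂ hY₂P => ?_⟩
  have h₂ := hC D χ hD hq hp hA j d r hd hr hdrP U hUd hUbd hU3 w hw Φ hΦ Y₂ hY₂ hY₂P
  have h₁ := hC D χ hD hq hp hA j d r hd hr hdrP U hUd hUbd hU3 w hw Φ hΦ Y₁ hY₁ hY₁P
  set V₂ := (1 / (2 * π) : ℂ) * (∫ t : ℝ, Φ (((1 : ℝ) : ℂ) + t * I) *
      ((Y₂ : ℂ) ^ (((1 : ℝ) : ℂ) + t * I + 0) * omega1 (ell D ^ 30) (((1 : ℝ) : ℂ) + t * I + 0) /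
        (((1 : ℝ) : ℂ) + t * I + 0))) with hV₂
  set V₁ := (1 / (2 * π) : ℂ) * (∫ t : ℝ, Φ (((1 : ℝ) : ℂ) + t * I) *
      ((Y₁ : ℂ) ^ (((1 : ℝ) : ℂ) + t * I + 0) * omega1 (ell D ^ 30) (((1 : ℝ) : ℂ) + t * I + 0) /
        (((1 : ℝ) : ℂ) + t * I + 0))) with hV₁
  set ellPi : ℂ := PiW χ d r * deriv χ.LFunction 1 with hellPi
  set βa : ℂ := betaJ c' D (j + 1) with hβa
  set βb : ℂ := betaJ c' D (j + 2) with hβb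
  set M₂ : ℂ := ellPi * (w - beta6 D + βa + βb + βa * βb * ((((Y₂ : ℝ) : ℂ) ^ (beta6 D - w) - 1) /
      (beta6 D - w))) with hM₂
  set M₁ : ℂ := ellPi * (w - beta6 D + βa + βb + βa * βb * ((((Y₁ : ℝ) : ℂ) ^ (beta6 D - w) - 1) /
      (beta6 D - w))) with hM₁
  have e : V₂ - V₁ - ellPi * (βa * βb * ((((Y₂ : ℝ) : ℂ) ^ (beta6 D - w) -
      ((Y₁ : ℝ) : ℂ) ^ (beta6 D - w)) / (beta6 D - w))) = (V₂ - M₂) - (V₁ - M₁) := by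
    rw [hM₂, hM₁]
    ring
  rw [e]
  refine (norm_sub_le _ _).trans ?_
  have h2C : 2 * C * (ell D ^ 15)⁻¹ * (∏ q ∈ (d * r).primeFactors, (1 - (q : ℝ)⁻¹)⁻¹) ^ 2 =
      C * (ell D ^ 15)⁻¹ * (∏ q ∈ (d * r).primeFactors, (1 - (q : ℝ)⁻¹)⁻¹) ^ 2 +
        C * (ell D ^ 15)⁻¹ * (∏ q ∈ (d * r).primeFactors, (1 - (q : ℝ)⁻¹)⁻¹) ^ 2 := by ring
  rw [h2C]
  exact add_le_add h₂ h₁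

end ShiftedContour

end Literature.NumberTheory.LFunctions.Zhang2022.Lemma84
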